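import Literature.NumberTheory.GaloisCohomology.PBasisKoszulHomotopy
import HarnessLib

/-!
# Side conditions of the Koszul contraction: `πd = dπ = 0`, `π² = π`, `hπ = πh = h² = 0`

Continuation of `PBasisKoszulOperators.lean` / `PBasisKoszulHomotopy.lean`.  For a ring `R` of characteristic
`p` with a finite `p`-basis, the Koszul contraction `h = IsPBasis.hTwist` and the Cartier projector
`π = IsPBasis.πTwist` on the Frobenius-twisted de Rham complex `(Ωⁿ_R, d = dTwist)` satisfy, besides the homotopy
identity `dh + hd = 1 - π`, the **side conditions of a strong deformation retraction**:

* `πTwist_dTwist : π ∘ d = 0` and `dTwist_πTwist : d ∘ π = 0` (the Cartier vectors `t_s^{p-1} dt_s` are closed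
  and `d` never produces them);
* `πTwist_πTwist : π ∘ π = π`;
* `hTwist_πTwist : h ∘ π = 0`, `πTwist_hTwist : π ∘ h = 0`, `hTwist_hTwist : h ∘ h = 0`;
* consequences `hTwist_dTwist_hTwist : h d h = h` and `dTwist_hTwist_dTwist : d h d = d`.

All are matrix computations on the monomial basis `E (α, s)` using the weight bookkeeping of
`DeRhamWeights.lean`.  They are what turns the homotopy identity into the decompositions
`Zⁿ = Bⁿ ⊕ im π` and `Ωⁿ = Bⁿ ⊕ ker h` of `CartierIsomorphism.lean`.

## References

* L. Illusie, *Complexe de de Rham–Witt et cohomologie cristalline*, Ann. Sci. ÉNS 12 (1979), 0.2. [Illusie1979]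
-/

noncomputable section

open scoped BigOperators
open KaehlerDifferential (D)
open Literature.AlgebraicGeometry.Crystalline (insertSign)

namespace Literature.NumberTheory.GaloisCohomology

universe u v

namespace IsPBasis

open DeRhamWeights

variable {p : ℕ} [hp : Fact p.Prime] {R : Type u} [CommRing R] [CharP R p] {ι : Type v} [Fintype ι]
  [LinearOrder ι] {t : ι → R} (h : IsPBasis p t)

/-! ### `π ∘ d = 0` -/

/-- `π` kills every term of `d (E (α, s))`: a moved vector `E (α - e_i, insert i s)` (`α i ≠ 0`) has the live
index `i`. [folklore] -/
theorem πVec_dMove (n : ℕ) (α : ι → Fin p) (s : Set.powersetCard ι n) {i : ι} (hi : i ∉ (s : Finset ι))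
    (hα : α i ≠ 0) : h.πVec (n + 1) (α - Pi.single i 1, insertIdx s i hi) = 0 := by
  apply h.πVec_of_live_nonempty
  rw [coe_insertIdx, live_dMove hi hα]
  exact ⟨i, (mem_live_iff_of_not_mem hi).2 hα⟩

/-- **`π ∘ d = 0`** on basis vectors. [folklore] -/
theorem πTwist_dTwist_basis (n : ℕ) (α : ι → Fin p) (s : Set.powersetCard ι n) :
    h.πTwist (n + 1) (dTwist p R n (h.twistFormBasis n (α, s))) = 0 := by
  rw [h.dTwist_twistFormBasis, map_sum]
  refine Finset.sum_eq_zero fun i _ => ?_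
  by_cases hi : i ∉ (s : Finset ι)
  · rw [dif_pos hi, map_zsmul, πTwist_basis]
    by_cases hα : α i = 0
    · rw [hα, Fin.val_zero, Nat.cast_zero, zero_mul, zero_zsmul]
    · rw [h.πVec_dMove n α s hi hα, smul_zero]
  · rw [dif_neg hi, map_zero]

/-- **`π ∘ d = 0`**: the exterior derivative never produces a Cartier vector. [cite: Illusie1979, 0.2] -/
theorem πTwist_dTwist (n : ℕ) (x : FrobeniusTwist p R (⋀[R]^n (Ω[R⁄ℤ]))) :
    h.πTwist (n + 1) (dTwist p R n x) = 0 := by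
  have key : h.πTwist (n + 1) ∘ₗ dTwist p R n = 0 := by
    refine (h.twistFormBasis n).ext fun αs => ?_
    obtain ⟨α, s⟩ := αs
    simpa using h.πTwist_dTwist_basis n α s
  exact LinearMap.congr_fun key x

/-! ### `d ∘ π = 0` -/

/-- A Cartier vector is closed: `d (E (α, s)) = 0` when `live α s = ∅` (all `α i = 0` off `s`). [folklore] -/
theorem dTwist_basis_of_live_eq_empty (n : ℕ) (α : ι → Fin p) (s : Set.powersetCard ι n)
    (hl : live α (s : Finset ι) = ∅) : dTwist p R n (h.twistFormBasis n (α, s)) = 0 := by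
  rw [h.dTwist_twistFormBasis]
  refine Finset.sum_eq_zero fun i _ => ?_
  by_cases hi : i ∉ (s : Finset ι)
  · rw [dif_pos hi, apply_eq_zero_of_live_eq_empty hl hi, Fin.val_zero, Nat.cast_zero, zero_mul, zero_zsmul]
  · rw [dif_neg hi]

/-- **`d ∘ π = 0`** on basis vectors. [folklore] -/
theorem dTwist_πTwist_basis (n : ℕ) (α : ι → Fin p) (s : Set.powersetCard ι n) :
    dTwist p R n (h.πTwist n (h.twistFormBasis n (α, s))) = 0 := by
  rw [πTwist_basis]
  by_cases hl : live α (s : Finset ι) = ∅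
  · rw [h.πVec_of_live_eq_empty n hl, h.dTwist_basis_of_live_eq_empty n α s hl]
  · rw [h.πVec_of_live_nonempty n (Finset.nonempty_iff_ne_empty.2 hl), map_zero]

/-- **`d ∘ π = 0`**: the Cartier vectors are closed. [cite: Illusie1979, 0.2] -/
theorem dTwist_πTwist (n : ℕ) (x : FrobeniusTwist p R (⋀[R]^n (Ω[R⁄ℤ]))) :
    dTwist p R n (h.πTwist n x) = 0 := by
  have key : dTwist p R n ∘ₗ h.πTwist n = 0 := by
    refine (h.twistFormBasis n).ext fun αs => ?_
    obtain ⟨α, s⟩ := αs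
    simpa using h.dTwist_πTwist_basis n α s
  exact LinearMap.congr_fun key x

/-! ### `π ∘ π = π`, `h ∘ π = 0` -/

/-- **`π ∘ π = π`** on basis vectors. [folklore] -/
theorem πTwist_πTwist_basis (n : ℕ) (α : ι → Fin p) (s : Set.powersetCard ι n) :
    h.πTwist n (h.πTwist n (h.twistFormBasis n (α, s))) = h.πTwist n (h.twistFormBasis n (α, s)) := by
  rw [πTwist_basis]
  by_cases hl : live α (s : Finset ι) = ∅
  · rw [h.πVec_of_live_eq_empty n hl, πTwist_basis, h.πVec_of_live_eq_empty n hl]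
  · rw [h.πVec_of_live_nonempty n (Finset.nonempty_iff_ne_empty.2 hl), map_zero]

/-- **`π` is a projector: `π ∘ π = π`.** [cite: Illusie1979, 0.2] -/
theorem πTwist_πTwist (n : ℕ) (x : FrobeniusTwist p R (⋀[R]^n (Ω[R⁄ℤ]))) :
    h.πTwist n (h.πTwist n x) = h.πTwist n x := by
  have key : h.πTwist n ∘ₗ h.πTwist n = h.πTwist n := by
    refine (h.twistFormBasis n).ext fun αs => ?_
    obtain ⟨α, s⟩ := αs
    simpa using h.πTwist_πTwist_basis n α s
  exact LinearMap.congr_fun key x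

/-- **`h ∘ π = 0`** on basis vectors (a Cartier vector has no live index, so `h` kills it). [folklore] -/
theorem hTwist_πTwist_basis (n : ℕ) (α : ι → Fin p) (s : Set.powersetCard ι (n + 1)) :
    h.hTwist n (h.πTwist (n + 1) (h.twistFormBasis (n + 1) (α, s))) = 0 := by
  rw [πTwist_basis]
  by_cases hl : live α (s : Finset ι) = ∅
  · rw [h.πVec_of_live_eq_empty (n + 1) hl, hTwist_basis, h.hVec_of_live_eq_empty n hl]
  · rw [h.πVec_of_live_nonempty (n + 1) (Finset.nonempty_iff_ne_empty.2 hl), map_zero]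

/-- **`h ∘ π = 0`.** [cite: Illusie1979, 0.2] -/
theorem hTwist_πTwist (n : ℕ) (x : FrobeniusTwist p R (⋀[R]^(n + 1) (Ω[R⁄ℤ]))) :
    h.hTwist n (h.πTwist (n + 1) x) = 0 := by
  have key : h.hTwist n ∘ₗ h.πTwist (n + 1) = 0 := by
    refine (h.twistFormBasis (n + 1)).ext fun αs => ?_
    obtain ⟨α, s⟩ := αs
    simpa using h.hTwist_πTwist_basis n α s
  exact LinearMap.congr_fun key x

/-! ### `π ∘ h = 0`, `h ∘ h = 0` -/

/-- The target vector of `h`: for the minimal live index `i₀ ∈ s` of `(α, s)`, the moved pair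
`(α + e_{i₀}, s ∖ i₀)` has the same (nonempty) live set, whose minimum `i₀` is NOT in `s ∖ i₀` — so both `π`
and `h` kill `E (α + e_{i₀}, s ∖ i₀)`. [folklore] -/
theorem πVec_hMove_eq_zero_and_hVec_hMove_eq_zero (n : ℕ) (α : ι → Fin p) (s : Set.powersetCard ι (n + 2))
    (hl : (live α (s : Finset ι)).Nonempty) {i₀ : ι} (hmin : (live α (s : Finset ι)).min' hl = i₀)
    (hi₀ : i₀ ∈ (s : Finset ι)) :
    h.πVec (n + 1) (α + Pi.single i₀ 1, eraseIdx s i₀ hi₀) = 0 ∧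
      h.hVec n (α + Pi.single i₀ 1, eraseIdx s i₀ hi₀) = 0 := by
  have hlive₀ : i₀ ∈ live α (s : Finset ι) := hmin ▸ Finset.min'_mem _ hl
  have hα₀ : (α i₀ : ℕ) + 1 < p := (mem_live_iff_of_mem hi₀).1 hlive₀
  have hlive : live (α + Pi.single i₀ 1) ((eraseIdx s i₀ hi₀ : Set.powersetCard ι (n + 1)) : Finset ι) =
      live α (s : Finset ι) := by
    rw [coe_eraseIdx]; exact live_hMove hi₀ hα₀
  have hl' : (live (α + Pi.single i₀ 1) ((eraseIdx s i₀ hi₀ : Set.powersetCard ι (n + 1)) : Finset ι)).Nonempty := by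
    rw [hlive]; exact hl
  have hmin' : (live (α + Pi.single i₀ 1) ((eraseIdx s i₀ hi₀ : Set.powersetCard ι (n + 1)) : Finset ι)).min' hl'
      = i₀ := (min'_eq_of_eq hlive _ _).trans hmin
  have hnot : i₀ ∉ ((eraseIdx s i₀ hi₀ : Set.powersetCard ι (n + 1)) : Finset ι) := by
    rw [coe_eraseIdx]; exact Finset.notMem_erase i₀ _
  exact ⟨h.πVec_of_live_nonempty (n + 1) hl', h.hVec_of_min_not_mem n hl' hmin' hnot⟩

/-- The same for `π` alone, in the lowest degree (`h : Ω¹ → Ω⁰`). [folklore] -/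
theorem πVec_hMove_eq_zero (n : ℕ) (α : ι → Fin p) (s : Set.powersetCard ι (n + 1))
    (hl : (live α (s : Finset ι)).Nonempty) {i₀ : ι} (hmin : (live α (s : Finset ι)).min' hl = i₀)
    (hi₀ : i₀ ∈ (s : Finset ι)) :
    h.πVec n (α + Pi.single i₀ 1, eraseIdx s i₀ hi₀) = 0 := by
  have hlive₀ : i₀ ∈ live α (s : Finset ι) := hmin ▸ Finset.min'_mem _ hl
  have hα₀ : (α i₀ : ℕ) + 1 < p := (mem_live_iff_of_mem hi₀).1 hlive₀
  apply h.πVec_of_live_nonempty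
  rw [coe_eraseIdx, live_hMove hi₀ hα₀]
  exact hl

/-- **`π ∘ h = 0`** on basis vectors. [folklore] -/
theorem πTwist_hTwist_basis (n : ℕ) (α : ι → Fin p) (s : Set.powersetCard ι (n + 1)) :
    h.πTwist n (h.hTwist n (h.twistFormBasis (n + 1) (α, s))) = 0 := by
  rw [hTwist_basis]
  by_cases hl : (live α (s : Finset ι)).Nonempty
  · by_cases hi₀ : (live α (s : Finset ι)).min' hl ∈ (s : Finset ι)
    · rw [h.hVec_of_min_mem n hl rfl hi₀, map_zsmul, πTwist_basis, h.πVec_hMove_eq_zero n α s hl rfl hi₀,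
        smul_zero]
    · rw [h.hVec_of_min_not_mem n hl rfl hi₀, map_zero]
  · rw [h.hVec_of_live_eq_empty n (Finset.not_nonempty_iff_eq_empty.1 hl), map_zero]

/-- **`π ∘ h = 0`.** [cite: Illusie1979, 0.2] -/
theorem πTwist_hTwist (n : ℕ) (x : FrobeniusTwist p R (⋀[R]^(n + 1) (Ω[R⁄ℤ]))) :
    h.πTwist n (h.hTwist n x) = 0 := by
  have key : h.πTwist n ∘ₗ h.hTwist n = 0 := by
    refine (h.twistFormBasis (n + 1)).ext fun αs => ?_
    obtain ⟨α, s⟩ := αs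
    simpa using h.πTwist_hTwist_basis n α s
  exact LinearMap.congr_fun key x

/-- **`h ∘ h = 0`** on basis vectors. [folklore] -/
theorem hTwist_hTwist_basis (n : ℕ) (α : ι → Fin p) (s : Set.powersetCard ι (n + 2)) :
    h.hTwist n (h.hTwist (n + 1) (h.twistFormBasis (n + 2) (α, s))) = 0 := by
  rw [hTwist_basis]
  by_cases hl : (live α (s : Finset ι)).Nonempty
  · by_cases hi₀ : (live α (s : Finset ι)).min' hl ∈ (s : Finset ι)
    · rw [h.hVec_of_min_mem (n + 1) hl rfl hi₀, map_zsmul, hTwist_basis,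
        (h.πVec_hMove_eq_zero_and_hVec_hMove_eq_zero n α s hl rfl hi₀).2, smul_zero]
    · rw [h.hVec_of_min_not_mem (n + 1) hl rfl hi₀, map_zero]
  · rw [h.hVec_of_live_eq_empty (n + 1) (Finset.not_nonempty_iff_eq_empty.1 hl), map_zero]

/-- **`h ∘ h = 0`.** [cite: Illusie1979, 0.2] -/
theorem hTwist_hTwist (n : ℕ) (x : FrobeniusTwist p R (⋀[R]^(n + 2) (Ω[R⁄ℤ]))) :
    h.hTwist n (h.hTwist (n + 1) x) = 0 := by
  have key : h.hTwist n ∘ₗ h.hTwist (n + 1) = 0 := by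
    refine (h.twistFormBasis (n + 2)).ext fun αs => ?_
    obtain ⟨α, s⟩ := αs
    simpa using h.hTwist_hTwist_basis n α s
  exact LinearMap.congr_fun key x

/-! ### Consequences: `h d h = h`, `d h d = d` -/

/-- **`h ∘ d ∘ h = h`.** [cite: Illusie1979, 0.2] -/
theorem hTwist_dTwist_hTwist (n : ℕ) (x : FrobeniusTwist p R (⋀[R]^(n + 1) (Ω[R⁄ℤ]))) :
    h.hTwist n (dTwist p R n (h.hTwist n x)) = h.hTwist n x := by
  cases n with
  | zero =>
    rw [h.hTwist_dTwist_zero, h.πTwist_hTwist, sub_zero]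
  | succ m =>
    have := h.dTwist_hTwist_add_hTwist_dTwist m (h.hTwist (m + 1) x)
    rw [h.hTwist_hTwist, map_zero, zero_add, h.πTwist_hTwist, sub_zero] at this
    exact this

/-- **`d ∘ h ∘ d = d`.** [cite: Illusie1979, 0.2] -/
theorem dTwist_hTwist_dTwist (n : ℕ) (x : FrobeniusTwist p R (⋀[R]^n (Ω[R⁄ℤ]))) :
    dTwist p R n (h.hTwist n (dTwist p R n x)) = dTwist p R n x := by
  have := h.dTwist_hTwist_add_hTwist_dTwist n (dTwist p R n x)
  rw [dTwist_dTwist, map_zero, add_zero, h.πTwist_dTwist, sub_zero] at this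
  exact this

/-! ### The decomposition of a form -/

/-- **Every twisted form of positive degree decomposes as `x = d (h x) + h (d x) + π x`.** [cite: Illusie1979, 0.2] -/
theorem eq_dh_add_hd_add_π (n : ℕ) (x : FrobeniusTwist p R (⋀[R]^(n + 1) (Ω[R⁄ℤ]))) :
    x = dTwist p R n (h.hTwist n x) + h.hTwist (n + 1) (dTwist p R (n + 1) x) + h.πTwist (n + 1) x := by
  rw [h.dTwist_hTwist_add_hTwist_dTwist, sub_add_cancel]

/-- **Every twisted `0`-form decomposes as `x = h (d x) + π x`.** [cite: Illusie1979, 0.2] -/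
theorem eq_hd_add_π_zero (x : FrobeniusTwist p R (⋀[R]^0 (Ω[R⁄ℤ]))) :
    x = h.hTwist 0 (dTwist p R 0 x) + h.πTwist 0 x := by
  rw [h.hTwist_dTwist_zero, sub_add_cancel]

/-- **A CLOSED form of positive degree is exact plus its Cartier projection: `x = d (h x) + π x`.**
[cite: Illusie1979, 0.2] -/
theorem eq_dh_add_π_of_dTwist_eq_zero (n : ℕ) (x : FrobeniusTwist p R (⋀[R]^(n + 1) (Ω[R⁄ℤ])))
    (hx : dTwist p R (n + 1) x = 0) : x = dTwist p R n (h.hTwist n x) + h.πTwist (n + 1) x := by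
  conv_lhs => rw [h.eq_dh_add_hd_add_π n x, hx, map_zero, add_zero]

/-- **A closed `0`-form is its Cartier projection.** [cite: Illusie1979, 0.2] -/
theorem eq_π_of_dTwist_eq_zero_zero (x : FrobeniusTwist p R (⋀[R]^0 (Ω[R⁄ℤ]))) (hx : dTwist p R 0 x = 0) :
    x = h.πTwist 0 x := by
  conv_lhs => rw [h.eq_hd_add_π_zero x, hx, map_zero, zero_add]

end IsPBasis

end Literature.NumberTheory.GaloisCohomology

end
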